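import Summits.ValiantsHypothesis.ValiantsHypothesis.Theses.FifoMatching
import Literature.Computability.AlgebraicComplexity.ValiantClassesProofs

/-!
# Crux `FifoMatching.NNNotVP` (stmt-ValiantsHypothesis-11615): the a.e. quantitative form of the
crux implies BOTH the crux and the new split piece `NNDivisionHard`

Helper toward item stmt-ValiantsHypothesis-11615 (`--supports`).  The division split of record is
`NNNotVP ⟸ ZeroOneTransfer ∧ NNDivisionHard` (glue `nnNotVP_of_subs`, landed).  This file records,
kernel-checked, where the pieces sit relative to ONE natural statement — the eventual
super-quasi-polynomial hardness of `NN_n` for general arithmetic circuits over `ℂ`,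

  `H_qp : ∀ c, ∃ n₀, ∀ n ≥ n₀, 2^((log₂ n + c)^c) < L_ℂ(NN_n)`:

* `nnNotVP_of_superQuasiPolyHard : H_qp → NNNotVP` (two lines: `VP ⊆ VQP`);
* together with `NNDivisionHard.OfGeneralHardness.nnDivisionHard_of_superQuasiPolyHard`
  (`Theorems/FifoMatchingNNDivisionHardOfGeneralHardness.lean`, Strassen's division elimination;
  not imported here to keep this file inside the route's own cone) the SAME `H_qp` gives
  `NNDivisionHard`.

Reading for the decomposition census: the child `NNDivisionHard` (stmt-21181) is not an
independent difficulty next to the parent — it follows from the parent's a.e./quasi-polynomial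
form; the transfer content of the split is carried by `ZeroOneTransfer` (stmt-5066) alone.
Honest framing: placement only; `NNNotVP`, `NNDivisionHard`, VP ≠ VNP remain OPEN.  Sorry-free,
axioms `propext`, `Classical.choice`, `Quot.sound`.
-/

noncomputable section

-- Sub = Summit single-conjunct layout: the duplicated namespace component is mandated by the tree.
set_option linter.dupNamespace false

namespace Summit.ValiantsHypothesis.ValiantsHypothesis.Theorems.FifoMatching.NNNotVP.OfGeneralHardness

open MvPolynomial Literature.Computability.AlgebraicComplexity
open scoped BigOperators

/-- **The a.e. super-quasi-polynomial hardness of `NN` implies `NNNotVP`** (`VP ⊆ VQP`,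
`IsVPFamily.isVQPFamily`): a `VP` family has complexity `≤ 2^((log₂ n + c)^c)` for some `c` and
all `n`, contradicting `H_qp` at `c` beyond its `n₀`. [folklore] -/
theorem nnNotVP_of_superQuasiPolyHard
    (H : ∀ c : ℕ, ∃ n₀ : ℕ, ∀ n ≥ n₀, 2 ^ ((Nat.log 2 n + c) ^ c) <
      complexity (∑ M : Fin (2 * n) → Fin (2 * n),
        if ((∀ i, M (M i) = i) ∧ (∀ i, M i ≠ i) ∧ ∀ i j, i < j → j < M j → M j < M i → False) then
          ∏ i : Fin (2 * n), (if i < M i then MvPolynomial.X (i, M i) else 1)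
        else (0 : MvPolynomial (Fin (2 * n) × Fin (2 * n)) ℂ))) :
    Summit.ValiantsHypothesis.ValiantsHypothesis.Theses.FifoMatching.NNNotVP := by
  intro hVP
  obtain ⟨c, hc⟩ := (IsVPFamily.isVQPFamily hVP).2
  obtain ⟨n₀, hn₀⟩ := H c
  exact absurd (lt_of_lt_of_le (hn₀ n₀ le_rfl) (hc n₀)) (lt_irrefl _)

end Summit.ValiantsHypothesis.ValiantsHypothesis.Theorems.FifoMatching.NNNotVP.OfGeneralHardness

end
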